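import Summits.SmoothPoincare4.SmoothPoincare4.Theorems.EntropyRungCompactShrinkerGapJensenVolumeBound
import Literature.Geometry.Riemannian.BakryEmeryHeatFlow
import Literature.Geometry.Lorentzian.RicciNormSq
import Literature.Geometry.Lorentzian.MetricNormSq
import HarnessLib

/-!
# `∫|Hess f|² e^{-f} dV = ½ ∫|∇f|² e^{-f} dV` on a closed normalised four-dimensional gradient shrinker
(stub `stub_weightedHessianEnergy_of_identities` of line `cgy-variance-pivot`, crux
`EntropyRung.CompactShrinkerGap`, item stmt-SmoothPoincare4-10870)

For a Riemannian metric `g` (Levi-Civita connection) on a closed `4`-manifold and a smooth `f`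
with `Ric + Hess f = g/2` and `R + |∇f|² = f` (a normalised gradient shrinker, `τ = 1`), GIVEN the
pointwise identities
(B) `ΔR = g⁻¹(dR, df) + R − 2|Ric|²` and (H) `|Hess f|² = |Ric|² + 1 − R`
(both landed separately; here they are hypotheses), the integrated weighted Bochner identity
`∫_M |Hess f|² e^{-f} dV_g = ½ ∫_M |∇f|² e^{-f} dV_g` holds (Cao–Zhu 2010, (3.6)–(3.7);
Cheng–Ribeiro–Zhou 2022, Lemma 1; the drift Laplacian bookkeeping of Carrillo–Ni 2009, §3–§4).

Proof (measure/integral bookkeeping only; every integrand is continuous on a compact manifold of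
finite volume):
(i) the weighted Green identity `∫ (ΔR − g⁻¹(df, dR)) e^{-f} dV = 0`
(`integral_weightedLaplacian_eq_zero`, i.e. `∫ Δ_f R dm = 0` for `dm = e^{-f} dV`) and (B) give
`∫ R e^{-f} = 2 ∫ |Ric|² e^{-f}`;
(ii) integrating (H) against `e^{-f} dV`: `∫|Hess f|² e^{-f} = ∫|Ric|² e^{-f} + ∫ e^{-f} − ∫ R e^{-f}`;
(iii) the normalisation `R = f − |∇f|²` and `∫ f e^{-f} = 2 ∫ e^{-f}`
(`integral_mul_exp_neg_eq_two_mul`, the integrated `Δ e^{-f} = (f − 2) e^{-f}`) give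
`∫ R e^{-f} = 2∫ e^{-f} − ∫|∇f|² e^{-f}`; combining, `∫|Hess f|² e^{-f} = ½ ∫|∇f|² e^{-f}`.
Checks: round `S⁴(√6)` (`f ≡ 2`, `Hess f = 0`): both sides `0`.
Everything is proved; no definition, no named fact.

References: H.-D. Cao, M. Zhu, arXiv:1008.0842, (3.6)–(3.7) [CaoZhu2010]; X. Cheng, E. Ribeiro Jr,
D. Zhou, arXiv:2203.14916, Lemma 1 [ChengRibeiroZhou2022]; J. A. Carrillo, L. Ni, Comm. Anal.
Geom. 17 (2009), §3–§4 [CarrilloNi2009]; J. M. Lee, *Introduction to Riemannian Manifolds* (2018),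
Problem 2-23 [Lee2018].
-/

noncomputable section

-- the registered namespace `Summit.SmoothPoincare4.SmoothPoincare4.Theorems` repeats a component
set_option linter.dupNamespace false

open Bundle Set Function Filter Module MeasureTheory
open scoped Manifold ContDiff Topology

namespace Summit.SmoothPoincare4.SmoothPoincare4.Theorems

open Literature.Geometry Literature.Geometry.Lorentzian Literature.Geometry.Riemannian
  Literature.Geometry.Lorentzian.PseudoRiemannianMetric

/-- **STUB `stub_weightedHessianEnergy_of_identities` of line `cgy-variance-pivot` — the integrated
weighted Bochner identity on a closed normalised shrinker, from the pointwise identities.** On a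
CLOSED 4-manifold with Riemannian `g` (Levi-Civita), smooth `f`, `Ric + Hess f = g/2`,
`R + |∇f|² = f`, and GIVEN (B) `ΔR = g⁻¹(dR, df) + R − 2|Ric|²` and (H) `|Hess f|² = |Ric|² + 1 − R`
for this `(g, f)`: `∫|Hess f|² e^{-f} dV = ½ ∫|∇f|² e^{-f} dV`. Proof: the weighted Green identity
`∫ (ΔR − g⁻¹(df, dR)) e^{-f} = 0` (`integral_weightedLaplacian_eq_zero`) and (B) give
`∫ R e^{-f} = 2∫|Ric|² e^{-f}`; integrating (H), `∫|Hess f|² e^{-f} = ∫ e^{-f} − ½∫ R e^{-f}`; the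
normalisation and `∫ f e^{-f} = 2∫ e^{-f}` (`integral_mul_exp_neg_eq_two_mul`) give
`∫ R e^{-f} = 2∫ e^{-f} − ∫|∇f|² e^{-f}`. Check: round `S⁴(√6)`: both sides `0`.
[cite: CaoZhu2010, (3.6)–(3.7)] [cite: ChengRibeiroZhou2022, Lemma 1]
[cite: CarrilloNi2009, §3 (3.1)–(3.2) and §4] -/
theorem stub_weightedHessianEnergy_of_identities :
    ∀ (M : Type) [TopologicalSpace M] [T2Space M] [SecondCountableTopology M]
      [ChartedSpace (EuclideanSpace ℝ (Fin 4)) M] [IsManifold (𝓡 4) ∞ M] [CompactSpace M]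
      [T3Space M] [MeasurableSpace M] [BorelSpace M]
      (g : Literature.Geometry.Lorentzian.PseudoRiemannianMetric (𝓡 4) ∞ (EuclideanSpace ℝ (Fin 4))
        (TangentSpace (𝓡 4) : M → Type _)) [g.HasLeviCivita] (f : M → ℝ) (hg : g.IsRiemannian),
      ContMDiff (𝓡 4) 𝓘(ℝ, ℝ) ∞ f →
      (∀ (x : M) (X Y : TangentSpace (𝓡 4) x),
        g.ricci x X Y + g.hessian f x X Y = (1 / 2 : ℝ) * g.val x X Y) →
      (∀ x : M, g.scalarCurvature x + g.gradSq f x = f x) →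
      (∀ x : M, g.dalembertian g.scalarCurvature x =
        g.innerDual x (mvfderiv (𝓡 4) g.scalarCurvature x : TangentSpace (𝓡 4) x →ₗ[ℝ] ℝ)
            (mvfderiv (𝓡 4) f x : TangentSpace (𝓡 4) x →ₗ[ℝ] ℝ) +
          g.scalarCurvature x - 2 * g.normSq x (g.ricci x)) →
      (∀ x : M, g.normSq x (g.hessian f x) = g.normSq x (g.ricci x) + 1 - g.scalarCurvature x) →
      ∫ x, g.normSq x (g.hessian f x) * Real.exp (-f x)
          ∂(Literature.Geometry.Lorentzian.riemannianMeasure (g.toContMDiffRiemannianMetric hg)) =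
        1 / 2 * ∫ x, g.gradSq f x * Real.exp (-f x)
          ∂(Literature.Geometry.Lorentzian.riemannianMeasure (g.toContMDiffRiemannianMetric hg)) := by
  intro M _ _ _ _ _ _ _ _ _ g _ f hg hf hsol hnorm hB hH
  -- `∫ f e^{-f} dV = 2 ∫ e^{-f} dV` (the integrated `Δ e^{-f} = (f − 2) e^{-f}`)
  have hfe := integral_mul_exp_neg_eq_two_mul M g f hg hf hsol hnorm
  -- the Riemannian measure is `g.riemVolume`
  have hV : g.riemVolume = riemannianMeasure (g.toContMDiffRiemannianMetric hg) :=
    PseudoRiemannianMetric.riemVolume_eq hg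
  rw [← hV] at hfe ⊢
  -- regularity of `R` and `f`
  have hR : ContMDiff (𝓡 4) 𝓘(ℝ, ℝ) ∞ g.scalarCurvature := g.contMDiff_scalarCurvature
  have hR2 : ContMDiff (𝓡 4) 𝓘(ℝ, ℝ) 2 g.scalarCurvature :=
    hR.of_le (WithTop.coe_le_coe.mpr le_top)
  have hf1 : ContMDiff (𝓡 4) 𝓘(ℝ, ℝ) 1 f := hf.of_le (by norm_num)
  -- continuity, hence integrability, of every integrand
  have hRc : Continuous g.scalarCurvature := hR.continuous
  have hQc : Continuous fun x ↦ g.normSq x (g.ricci x) := g.contMDiff_normSq_ricci'.continuous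
  have hGc : Continuous (g.gradSq f) := continuous_innerDual_mvfderiv g hf1 hf1
  have hec : Continuous fun x ↦ Real.exp (-f x) := Real.continuous_exp.comp hf.continuous.neg
  have ie : Integrable (fun x ↦ Real.exp (-f x)) g.riemVolume := g.integrable_of_continuous hec
  have iRe : Integrable (fun x ↦ g.scalarCurvature x * Real.exp (-f x)) g.riemVolume :=
    g.integrable_of_continuous (hRc.mul hec)
  have iQe : Integrable (fun x ↦ g.normSq x (g.ricci x) * Real.exp (-f x)) g.riemVolume :=
    g.integrable_of_continuous (hQc.mul hec)
  have iGe : Integrable (fun x ↦ g.gradSq f x * Real.exp (-f x)) g.riemVolume :=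
    g.integrable_of_continuous (hGc.mul hec)
  have ife : Integrable (fun x ↦ f x * Real.exp (-f x)) g.riemVolume :=
    g.integrable_of_continuous (hf.continuous.mul hec)
  -- (1) the weighted Green identity `∫ (ΔR − g⁻¹(df, dR)) e^{-f} = 0` and (B):
  --     `∫ R e^{-f} − 2 ∫ |Ric|² e^{-f} = 0`
  have e1 : ∫ x, g.scalarCurvature x * Real.exp (-f x) ∂g.riemVolume -
      2 * ∫ x, g.normSq x (g.ricci x) * Real.exp (-f x) ∂g.riemVolume = 0 := by
    have h0 := integral_weightedLaplacian_eq_zero g hg hR2 hf1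
    have hpt : ∀ x, (g.dalembertian g.scalarCurvature x -
        g.innerDual x (mvfderiv (𝓡 4) f x : TangentSpace (𝓡 4) x →ₗ[ℝ] ℝ)
          (mvfderiv (𝓡 4) g.scalarCurvature x : TangentSpace (𝓡 4) x →ₗ[ℝ] ℝ)) *
          Real.exp (-f x) =
        g.scalarCurvature x * Real.exp (-f x) -
          2 * (g.normSq x (g.ricci x) * Real.exp (-f x)) := fun x ↦ by
      rw [hB x, g.innerDual_comm x (mvfderiv (𝓡 4) f x : TangentSpace (𝓡 4) x →ₗ[ℝ] ℝ)]
      ring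
    have h1 : ∫ x, (g.scalarCurvature x * Real.exp (-f x) -
        2 * (g.normSq x (g.ricci x) * Real.exp (-f x))) ∂g.riemVolume = 0 := by
      rw [← h0]
      exact integral_congr_ae (ae_of_all _ fun x ↦ (hpt x).symm)
    rwa [integral_sub iRe (iQe.const_mul 2), integral_const_mul] at h1
  -- (2) integrating (H): `∫|Hess f|² e^{-f} = ∫|Ric|² e^{-f} + ∫ e^{-f} − ∫ R e^{-f}`
  have e2 : ∫ x, g.normSq x (g.hessian f x) * Real.exp (-f x) ∂g.riemVolume =
      ∫ x, g.normSq x (g.ricci x) * Real.exp (-f x) ∂g.riemVolume +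
        ∫ x, Real.exp (-f x) ∂g.riemVolume -
        ∫ x, g.scalarCurvature x * Real.exp (-f x) ∂g.riemVolume := by
    have hpt : ∀ x, g.normSq x (g.hessian f x) * Real.exp (-f x) =
        g.normSq x (g.ricci x) * Real.exp (-f x) + Real.exp (-f x) -
          g.scalarCurvature x * Real.exp (-f x) := fun x ↦ by
      rw [hH x]
      ring
    have i₁ : Integrable (fun x ↦ g.normSq x (g.ricci x) * Real.exp (-f x) + Real.exp (-f x))
        g.riemVolume := iQe.add ie
    rw [integral_congr_ae (ae_of_all _ hpt), integral_sub i₁ iRe, integral_add iQe ie]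
  -- (3) integrating the normalisation `R = f − |∇f|²`: `∫ R e^{-f} = ∫ f e^{-f} − ∫|∇f|² e^{-f}`
  have e3 : ∫ x, g.scalarCurvature x * Real.exp (-f x) ∂g.riemVolume =
      ∫ x, f x * Real.exp (-f x) ∂g.riemVolume -
        ∫ x, g.gradSq f x * Real.exp (-f x) ∂g.riemVolume := by
    have hpt : ∀ x, g.scalarCurvature x * Real.exp (-f x) =
        f x * Real.exp (-f x) - g.gradSq f x * Real.exp (-f x) := fun x ↦ by
      rw [← hnorm x]
      ring
    rw [integral_congr_ae (ae_of_all _ hpt), integral_sub ife iGe]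
  rw [e2]
  linarith [e1, e3, hfe]

end Summit.SmoothPoincare4.SmoothPoincare4.Theorems

end
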